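import Summits.KontsevichZagierPeriods.KontsevichZagierPeriods.Theses.HyperbolicBloch
import Literature.NumberTheory.Transcendental.KZHyperbolicLadder
import Literature.NumberTheory.Transcendental.KZCubicalCalculus
import Literature.NumberTheory.Transcendental.KZCalculusProofs
import Literature.NumberTheory.Transcendental.KZVolumeConjectureProofs
import Literature.NumberTheory.Transcendental.KZRulesAssociator
import Literature.NumberTheory.Transcendental.KZProductIdeal
import Literature.NumberTheory.Transcendental.KZRayDilog
import Literature.NumberTheory.Transcendental.KZLogCalculusProofs
import Summits.KontsevichZagierPeriods.KontsevichZagierPeriods.Theorems.HyperbolicBlochOffTetraSectorKernelStubRungZero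
import Summits.KontsevichZagierPeriods.KontsevichZagierPeriods.Theorems.HyperbolicBlochOffTetraSectorKernelRungOne
import Summits.KontsevichZagierPeriods.KontsevichZagierPeriods.Theorems.HyperbolicBlochOffTetraSectorKernelRungTwo
import Summits.KontsevichZagierPeriods.KontsevichZagierPeriods.Theorems.SymplecticScissorsVolumeFormOffPlaneDimLeOne
import Summits.KontsevichZagierPeriods.KontsevichZagierPeriods.Theorems.HyperbolicBlochOffTetraSectorKernelStubKernelOfValueOne
import Summits.KontsevichZagierPeriods.KontsevichZagierPeriods.Theorems.HyperbolicBlochOffTetraSectorKernelStubValueOneOfOrbit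
import Summits.KontsevichZagierPeriods.KontsevichZagierPeriods.Theorems.HyperbolicBlochOffTetraSectorKernelStubCubeDensityTransfer
import Summits.KontsevichZagierPeriods.KontsevichZagierPeriods.Theorems.HyperbolicBlochOffTetraSectorKernelStubDimensionDrop
import Summits.KontsevichZagierPeriods.KontsevichZagierPeriods.Theorems.HyperbolicBlochOffTetraSectorKernelStubAffineOrbit
import Summits.KontsevichZagierPeriods.KontsevichZagierPeriods.Theorems.HyperbolicBlochOffTetraSectorKernelResidueForms
import Summits.KontsevichZagierPeriods.KontsevichZagierPeriods.Theorems.HyperbolicBlochOffTetraSectorKernelWeightOneEnvelope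
import Summits.KontsevichZagierPeriods.KontsevichZagierPeriods.Theorems.HyperbolicBlochOffTetraSectorKernelJointLayer
import Summits.KontsevichZagierPeriods.KontsevichZagierPeriods.Theorems.HyperbolicBlochOffTetraSectorKernelStubLindemannRing
import Summits.KontsevichZagierPeriods.KontsevichZagierPeriods.Theorems.HyperbolicBlochOffTetraSectorKernelLindemannRingMembers
import Summits.KontsevichZagierPeriods.KontsevichZagierPeriods.Theorems.HyperbolicBlochOffTetraSectorKernelLindemannRingZeta
import Summits.KontsevichZagierPeriods.KontsevichZagierPeriods.Theorems.HyperbolicBlochOffTetraSectorKernelStubHermiteLindemannRing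
import Summits.KontsevichZagierPeriods.KontsevichZagierPeriods.Theorems.HyperbolicBlochOffTetraSectorKernelStubChudnovskyRing
import Summits.KontsevichZagierPeriods.KontsevichZagierPeriods.Theorems.HyperbolicBlochOffTetraSectorKernelStubEquianharmonicRing
import Summits.KontsevichZagierPeriods.KontsevichZagierPeriods.Theorems.HyperbolicBlochOffTetraSectorKernelStubLegendreRing
import Summits.KontsevichZagierPeriods.KontsevichZagierPeriods.Theorems.HyperbolicBlochOffTetraSectorKernelRealBloch
import Summits.KontsevichZagierPeriods.KontsevichZagierPeriods.Theorems.HyperbolicBlochOffTetraSectorKernelSphericalRungOne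
import Summits.KontsevichZagierPeriods.KontsevichZagierPeriods.Theorems.HyperbolicBlochOffTetraSectorKernelGlue
import Summits.KontsevichZagierPeriods.KontsevichZagierPeriods.Theorems.BetaCancellation.Negative.Torsion
import Summits.KontsevichZagierPeriods.KontsevichZagierPeriods.Theorems.HyperbolicBlochOffTetraSectorKernelStubRaySqrt
import Summits.KontsevichZagierPeriods.KontsevichZagierPeriods.Theorems.HyperbolicBlochOffTetraSectorKernelStubBandPowerSubst
import Summits.KontsevichZagierPeriods.KontsevichZagierPeriods.Theorems.HyperbolicBlochOffTetraSectorKernelStubBandLogPower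
import Summits.KontsevichZagierPeriods.KontsevichZagierPeriods.Theorems.HyperbolicBlochOffTetraSectorKernelStubArcDistribution
import Summits.KontsevichZagierPeriods.KontsevichZagierPeriods.Theorems.HyperbolicBlochOffTetraSectorKernelStubLogBandsExist
import Summits.KontsevichZagierPeriods.KontsevichZagierPeriods.Theorems.HyperbolicBlochOffTetraSectorKernelBridge
import Summits.KontsevichZagierPeriods.KontsevichZagierPeriods.Theorems.HyperbolicBlochOffTetraSectorKernelStubRaySplit
import Summits.KontsevichZagierPeriods.KontsevichZagierPeriods.Theorems.HyperbolicBlochOffTetraSectorKernelStubRayCarriersExist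
import Summits.KontsevichZagierPeriods.KontsevichZagierPeriods.Theorems.HyperbolicBlochOffTetraSectorKernelDistribution
import Summits.KontsevichZagierPeriods.KontsevichZagierPeriods.Theorems.HyperbolicBlochOffTetraSectorKernelStubDivisibleOfDistribution
import Summits.KontsevichZagierPeriods.KontsevichZagierPeriods.Theorems.HyperbolicBlochOffTetraSectorKernelRationalZagier

/-!
# Skeleton v11 (FINAL, v11c) — crux `OffTetraSectorKernel` (stmt-KontsevichZagierPeriods-10557), line `odd-hyperbolic-ladder`

Continuation lead c8 (prover-line-stmt-KontsevichZagierPeriods-10557-c8-0). History: v1 (planners) → v2 (c1: scissors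
transfer, rung 0) → v3 (c2: the `ℚ̄`-tetrahedron sector of `ℍ³` IS the Bloch–Wigner sector) → v4/v5 (c3: rungs 0, 1 close,
rung 2 is the sector) → v6 (c4: value-one / cube-orbit / Moser forms of the residue; affine sector) → v7 (c5: the weight-one
envelope, Baker) → v8 (c6: Lindemann / one-log / Chudnovsky / equianharmonic / Legendre rings; the real dilogarithm's
functional equations) → v9/v10 (c7: Abel's five-term equation as moves, Rogers' real Bloch group, the spherical rung 1) →
**v11 (this file): THE BLOCH–WIGNER ORACLE IS DIVISIBLE INSIDE THE CALCULUS.**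

The disprover's last open refutation door (`Cruxes/…/Disproof.lean` §6 `not_of_torsion`: a torsion class of
`FormalRep ⧸ (relations ⊔ closure tetraRelators)` would kill the crux; under the crux there is none) is closed
UNCONDITIONALLY. For every `k ≥ 1` and every `z ∈ ℚ̄ ∩ ℍ⁺` the DISTRIBUTION RELATION
`[T(z)] ≡ k · Σ_{w^k = z} B(w)` (`B(w) = [T(w)]`, `−[T(w̄)]`, `0` by the sign of `Im w`) is a chain of Kontsevich–Zagier moves.
In print the divisibility of the Bloch group of `ℚ̄` is regulator/rigidity theory (Dupont–Sah 1982 §5, Suslin); Zagier's RAY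
integral `D(z) = ∫₀¹ log(s|z|) · Im(z/(1 − s z)) ds` (tree: `KZ.rayDilogRep`, and the landed Milnor bridge
`[T(z), t⁻³] ∼ rayDilogRep`, line flat-shadow) makes it ELEMENTARY inside the calculus:
* `stub_raySqrt`, `stub_raySplit`: `[ray(z)] ≡ [Band(z)] − [C(z) × Λ±(|z|)]` — `Band(z) = [{0<s<1, 1≤u≤1/s}, g_z(s)/u]`
  (value `Im Li₂(z)`), `C(z) = [(0,1), g_z]` (value `−arg(1−z)`), `Λ±(r)` the signed log sheet (value `log r`),
  `g_z(s) = Im z / ((1 − s Re z)² + (s Im z)²) = Im (z/(1 − s z))`;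
* `stub_bandPowerSubst` (rule (2), `s = t^k`), `stub_bandLogPower` (the unfolded product rule `log(1/t^k) = k log(1/t)`,
  rules (1a)+(2)), `stub_bandPartialFractions` / `stub_arcDistribution` (rule (1b) with the identity
  `Σ_{w^k=z} Im(w/(1 − w t)) = k t^{k−1} Im(z/(1 − z t^k))`, `stub_rootsPartialFractions`), `stub_logSheetPower`
  (rung 0: `log |z| = k log |w|`); existence of the carriers (`stub_logBandsExist`, `stub_rayCarriersExist`);
* lead: `stub_distribution` (`[ρ z] − k·Σⱼ εⱼ [ρ uⱼ] ∈ relations`, composed from `stub_rayChain` at `z` and at each root,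
  the band/arc/sheet distributions, the product ideal and `stub_conjCarriers`; roots by `stub_kthRootsExist`), whence
  `oracle_divisible` (via `stub_divisibleOfDistribution`: every tetrahedral value-relator `d` is `≡ k · d′` for a
  tetrahedral value-relator `d′`, the value of `d′` vanishing by SOUNDNESS), `torsionFree_sup_closure_tetra`:
  `FormalRep ⧸ (relations ⊔ closure tetraRelators)` is torsion-free, the crux is equivalent to its `ℚ`-form
  (`offTetraSectorKernel_iff_rationalForm`), and the REMAINDER drops to the `ℚ`-MOSER FORM (`stub_rationalMoserModOracle`:
  SOME positive multiple of `[G] − [Q]` is move-trivial modulo the oracle);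
* epilogue (`ℚ`-forms): the PRINTED `ℚ`-form of Zagier's conjecture already gives `TetraSector` and the route
  (`tetraSector_of_rationalZagier`, `kontsevichZagierPeriods_of_rationalZagier`) — no unique divisibility of `B(ℚ̄)` needed;
  by soundness the VALUES obey `D(z) = k Σⱼ εⱼ D(uⱼ)` (`rayDilog_distribution`).

REMAINDER (`stub_rationalMoserModOracle`, crux-equivalent, summit-strength by Disproof §1, NOT a proof target): the
`ℚ`-Moser form modulo tetra ⊔ rung 2 ⊔ weight-one envelope ⊔ affine sector ⊔ Lindemann ⊔ Chudnovsky ⊔ one-log rings ⊔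
equianharmonic ⊔ Legendre rings ⊔ the spherical-rung-1 envelope (c7's v10).
-/

noncomputable section

open Set MeasureTheory
open Literature.NumberTheory.Transcendental

namespace Summit.KontsevichZagierPeriods.HyperbolicBloch.OffTetraSectorKernel

/-! ## v11 — everything but the remainder is LANDED (imported above)

* wave 1: `stub_raySqrt` (p140997), `stub_raySplit` (p143603, + Aux p141792), `stub_bandPowerSubst` (p141034),
  `stub_bandLogPower` (p140994), `stub_arcDistribution` (p141194), `stub_logBandsExist` (p141698), `stub_rayCarriersExist`
  (p143403, + Ray p141447);
* wave 2: `stub_rootsPartialFractions` (p144980), `stub_bandPartialFractions` (p144362), `stub_logSheetPower` (p144931),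
  `stub_kthRootsExist` (p144509), `stub_rayChain` (p145054), `stub_conjCarriers` (p144510), `stub_divisibleOfDistribution`
  (p144571);
* lead: `stub_distribution` + `distribution_idealTetrahedronRep` / `idealTetrahedronVolume_distribution` /
  `rayDilog_distribution` (Theorems/…Distribution.lean, p147501); compositions `oracle_divisible`, `closure_tetra_divisible`,
  `torsionFree_sup_closure_tetra`, `offTetraSectorKernel_iff_rationalForm` (Theorems/…TorsionFree.lean, p148856 — duplicated inline below until that module is built on the farm); epilogue
  `tetraSector_of_rationalZagier`, `kontsevichZagierPeriods_of_rationalZagier` (Theorems/…RationalZagier.lean, p146060).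
-/

/-- `stub_oracleDivisible` (v11 assembly, now a THEOREM from `stub_distribution` + `stub_divisibleOfDistribution`): THE BLOCH–WIGNER ORACLE IS DIVISIBLE — for every `k ≥ 1`,
every tetrahedral value-relator `d = Σ nᵢ•[ρ zᵢ]` is congruent modulo `KZ.relations` to `k • d′` for another tetrahedral
value-relator `d′` (over the same admissible family): `d′ = Σᵢ nᵢ • Σ_{w^k = zᵢ} B_ρ(w)` by the distribution relations
(Milnor bridge to the ray form, `stub_raySqrt` … `stub_logSheetPower`), its value vanishing by soundness.
[cite: DupontSah1982, §5] -/
theorem stub_oracleDivisible :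
    ∀ (T : ℂ → Set (Fin 3 → ℝ)), (∀ z, T z = {p | 0 < p 1 ∧ z.re * p 1 < z.im * p 0 ∧ z.im * (p 0 - 1) < (z.re - 1) * p 1 ∧ 0 < p 2 ∧ 0 < z.im * (p 0 ^ 2 + p 1 ^ 2 + p 2 ^ 2 - p 0) + (z.re - Complex.normSq z) * p 1}) →
    ∀ (k : ℕ), 1 ≤ k → ∀ d ∈ {d : KZ.FormalRep | ∃ ρ : ℂ → KZ.IntegralRep 3, (∀ z, IsAlgebraic ℚ z → 0 < z.im → (ρ z).domain = T z ∧ Set.EqOn (ρ z).integrand (fun p => 1 / p 2 ^ 3) (T z)) ∧ ∃ (k : ℕ) (z : Fin k → ℂ) (n : Fin k → ℤ), (∀ i, IsAlgebraic ℚ (z i)) ∧ (∀ i, 0 < (z i).im) ∧ ∑ i, (n i : ℝ) * (ρ (z i)).value = 0 ∧ d = ∑ i, n i • KZ.of (ρ (z i))},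
      ∃ d' ∈ {d : KZ.FormalRep | ∃ ρ : ℂ → KZ.IntegralRep 3, (∀ z, IsAlgebraic ℚ z → 0 < z.im → (ρ z).domain = T z ∧ Set.EqOn (ρ z).integrand (fun p => 1 / p 2 ^ 3) (T z)) ∧ ∃ (k : ℕ) (z : Fin k → ℂ) (n : Fin k → ℤ), (∀ i, IsAlgebraic ℚ (z i)) ∧ (∀ i, 0 < (z i).im) ∧ ∑ i, (n i : ℝ) * (ρ (z i)).value = 0 ∧ d = ∑ i, n i • KZ.of (ρ (z i))}, d - k • d' ∈ KZ.relations := by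
  intro T hT k hk d hd
  exact stub_divisibleOfDistribution T (stub_distribution T hT) k hk d hd

/-! ## Remainder and composition -/

/-- STUB `stub_rationalMoserModOracle` (REMAINDER — crux-equivalent, summit-strength; NOT a proof target): the `ℚ`-MOSER
FORM of Conjecture 1 modulo the tetrahedral value-relators, the Bloch–Wigner rung (rung 2), the weight-one envelope, the
Euclidean affine sector, Lindemann's, Chudnovsky's, the one-logarithm, the equianharmonic and Legendre's rings, and the
spherical-rung-1 envelope: for every non-negative `ℚ`-semialgebraic density of mass `1` on a unit cube, SOME POSITIVE INTEGER
MULTIPLE of its difference with the uniform density is move-trivial modulo those (v11: the multiple is harmless because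
`FormalRep ⧸ (relations ⊔ closure tetra)` is torsion-free, `torsionFree_sup_closure_tetra`). [cite: KontsevichZagier2001, §1.2] -/
theorem stub_rationalMoserModOracle :
    ∀ (T : ℂ → Set (Fin 3 → ℝ)), (∀ z, T z = {p | 0 < p 1 ∧ z.re * p 1 < z.im * p 0 ∧
      z.im * (p 0 - 1) < (z.re - 1) * p 1 ∧ 0 < p 2 ∧
      0 < z.im * (p 0 ^ 2 + p 1 ^ 2 + p 2 ^ 2 - p 0) + (z.re - Complex.normSq z) * p 1}) →
    ∀ (d : ℕ) (G Q : KZ.IntegralRep (d + 1)), G.domain = KZ.cube (d + 1) →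
      (∀ x ∈ G.domain, 0 ≤ G.integrand x) → Q.domain = KZ.cube (d + 1) →
      (∀ x ∈ Q.domain, Q.integrand x = 1) → G.value = 1 →
      ∃ N : ℕ, N ≠ 0 ∧ N • (KZ.of G - KZ.of Q) ∈ KZ.relations ⊔ (AddSubgroup.closure {d : KZ.FormalRep | ∃ ρ : ℂ → KZ.IntegralRep 3,
          (∀ z, IsAlgebraic ℚ z → 0 < z.im → (ρ z).domain = T z ∧
            Set.EqOn (ρ z).integrand (fun p => 1 / p 2 ^ 3) (T z)) ∧
          ∃ (k : ℕ) (z : Fin k → ℂ) (n : Fin k → ℤ), (∀ i, IsAlgebraic ℚ (z i)) ∧ (∀ i, 0 < (z i).im) ∧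
            ∑ i, (n i : ℝ) * (ρ (z i)).value = 0 ∧ d = ∑ i, n i • KZ.of (ρ (z i))} ⊔
        AddSubgroup.closure (KZ.rungRelators 2) ⊔
        (KZ.eval.ker ⊓ AddSubgroup.closure
          ({y : KZ.FormalRep | ∃ r : KZ.IntegralRep 1, KZ.IsGeodesicPolytope 0 r.domain ∧
              Set.EqOn r.integrand (KZ.hypDensity 0) r.domain ∧ y = KZ.of r} ∪
            {y | ∃ r : KZ.IntegralRep 2, KZ.IsGeodesicPolytope 1 r.domain ∧
              Set.EqOn r.integrand (KZ.hypDensity 1) r.domain ∧ y = KZ.of r} ∪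
            {y | ∃ (d : ℕ) (A : Matrix (Fin d) (Fin d) ℝ) (b : Fin d → ℝ) (r : KZ.IntegralRep d),
              (∀ j l, IsAlgebraic ℚ (A j l)) ∧ (∀ j, IsAlgebraic ℚ (b j)) ∧ A.det ≠ 0 ∧
              r.domain = (fun x => A.mulVec x + b) '' {x | (∀ i, 0 < x i) ∧ ∑ i, x i < 1} ∧
              (∀ x ∈ r.domain, r.integrand x = 1) ∧ y = KZ.of r} ∪
            {y | ∃ (A : Matrix (Fin 2) (Fin 2) ℝ) (b : Fin 2 → ℝ) (r : KZ.IntegralRep 2),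
              (∀ j l, IsAlgebraic ℚ (A j l)) ∧ (∀ j, IsAlgebraic ℚ (b j)) ∧ A.det ≠ 0 ∧
              r.domain = (fun x => A.mulVec x + b) '' {p | p 0 ^ 2 + p 1 ^ 2 < 1} ∧
              (∀ x ∈ r.domain, r.integrand x = 1) ∧ y = KZ.of r} ∪
            {y | ∃ (m : ℕ) (N : KZ.IntegralRep m), m ≤ 1 ∧ N.IsRational ∧ y = KZ.of N})) ⊔
        AddSubgroup.closure {c : KZ.FormalRep | ∃ (d k : ℕ) (B : Set (Fin d → ℝ))
          (A : Fin k → Matrix (Fin d) (Fin d) ℝ) (b : Fin k → Fin d → ℝ) (m : Fin k → ℤ)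
          (r : Fin k → KZ.IntegralRep d), Literature.ModelTheory.ExponentialFields.IsSemialgebraic ℚ B ∧
          volume B ≠ ⊤ ∧ (∀ i j l, IsAlgebraic ℚ (A i j l)) ∧ (∀ i j, IsAlgebraic ℚ (b i j)) ∧
          (∀ i, (A i).det ≠ 0) ∧ (∀ i, (r i).domain = (fun x => (A i).mulVec x + b i) '' B) ∧
          (∀ i, ∀ x ∈ (r i).domain, (r i).integrand x = 1) ∧ ∑ i, (m i : ℝ) * (r i).value = 0 ∧
          c = ∑ i, m i • KZ.of (r i)} ⊔
        (KZ.eval.ker ⊓ (Subring.closure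
          ({p : KZ.FormalPeriodRing | ∃ (a : ℝ) (ha : IsAlgebraic ℚ a),
              p = KZ.toFormalPeriod (KZ.of (KZ.IntegralRep.unit.constMul a ha))} ∪
            {p : KZ.FormalPeriodRing | ∃ A : KZ.IntegralRep 1, A.domain = {t | t 0 ∈ Set.Ioo (0:ℝ) 1} ∧
              Set.EqOn A.integrand (fun t => 1 / (1 + t 0 ^ 2)) A.domain ∧
              p = KZ.toFormalPeriod (KZ.of A)})).toAddSubgroup.comap
          KZ.toFormalPeriod.toAddMonoidHom) ⊔
        (KZ.eval.ker ⊓ (Subring.closure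
          ({p : KZ.FormalPeriodRing | ∃ (a : ℝ) (ha : IsAlgebraic ℚ a),
              p = KZ.toFormalPeriod (KZ.of (KZ.IntegralRep.unit.constMul a ha))} ∪
            ({p : KZ.FormalPeriodRing | ∃ A : KZ.IntegralRep 1, A.domain = {t | t 0 ∈ Set.Ioo (0:ℝ) 1} ∧
              Set.EqOn A.integrand (fun t => 1 / (1 + t 0 ^ 2)) A.domain ∧ p = KZ.toFormalPeriod (KZ.of A)} ∪
            {p : KZ.FormalPeriodRing | ∃ H : KZ.IntegralRep 1, H.domain = {t | t 0 ∈ Set.Ioo (0:ℝ) 1} ∧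
              Set.EqOn H.integrand (fun t => (t 0) ^ (((1 / 4 : ℚ) : ℝ) - 1) * (1 - t 0) ^ (((1 / 2 : ℚ) : ℝ) - 1))
                H.domain ∧ p = KZ.toFormalPeriod (KZ.of H)}))).toAddSubgroup.comap
          KZ.toFormalPeriod.toAddMonoidHom) ⊔
        AddSubgroup.closure {c : KZ.FormalRep | ∃ a : ℝ, IsAlgebraic ℚ a ∧ 1 < a ∧ KZ.eval c = 0 ∧
          KZ.toFormalPeriod c ∈ Subring.closure
            ({p : KZ.FormalPeriodRing | ∃ (c : ℝ) (hc : IsAlgebraic ℚ c),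
                p = KZ.toFormalPeriod (KZ.of (KZ.IntegralRep.unit.constMul c hc))} ∪
              {p : KZ.FormalPeriodRing | ∃ Λ : KZ.IntegralRep 1, Λ.domain = {t | 1 < t 0 ∧ t 0 < a} ∧
                Set.EqOn Λ.integrand (fun t => 1 / t 0) Λ.domain ∧ p = KZ.toFormalPeriod (KZ.of Λ)})} ⊔
        (KZ.eval.ker ⊓ (Subring.closure
          ({p : KZ.FormalPeriodRing | ∃ (a : ℝ) (ha : IsAlgebraic ℚ a),
              p = KZ.toFormalPeriod (KZ.of (KZ.IntegralRep.unit.constMul a ha))} ∪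
            ({p : KZ.FormalPeriodRing | ∃ A : KZ.IntegralRep 1, A.domain = {t | t 0 ∈ Set.Ioo (0:ℝ) 1} ∧
              Set.EqOn A.integrand (fun t => 1 / (1 + t 0 ^ 2)) A.domain ∧ p = KZ.toFormalPeriod (KZ.of A)} ∪
            {p : KZ.FormalPeriodRing | ∃ H : KZ.IntegralRep 1, H.domain = {t | t 0 ∈ Set.Ioo (0:ℝ) 1} ∧
              Set.EqOn H.integrand (fun t => (t 0) ^ (((1 / 3 : ℚ) : ℝ) - 1) * (1 - t 0) ^ (((1 / 3 : ℚ) : ℝ) - 1))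
                H.domain ∧ p = KZ.toFormalPeriod (KZ.of H)}))).toAddSubgroup.comap
          KZ.toFormalPeriod.toAddMonoidHom) ⊔
        (KZ.eval.ker ⊓ (Subring.closure
          ({p : KZ.FormalPeriodRing | ∃ (a : ℝ) (ha : IsAlgebraic ℚ a),
              p = KZ.toFormalPeriod (KZ.of (KZ.IntegralRep.unit.constMul a ha))} ∪
            ({p : KZ.FormalPeriodRing | ∃ A : KZ.IntegralRep 1, A.domain = {t | t 0 ∈ Set.Ioo (0:ℝ) 1} ∧
              Set.EqOn A.integrand (fun t => 1 / (1 + t 0 ^ 2)) A.domain ∧ p = KZ.toFormalPeriod (KZ.of A)} ∪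
            {p : KZ.FormalPeriodRing | ∃ H : KZ.IntegralRep 1, H.domain = {t | t 0 ∈ Set.Ioo (0:ℝ) 1} ∧
              Set.EqOn H.integrand (fun t => (t 0) ^ (((1 / 4 : ℚ) : ℝ) - 1) * (1 - t 0) ^ (((1 / 2 : ℚ) : ℝ) - 1))
                H.domain ∧ p = KZ.toFormalPeriod (KZ.of H)} ∪
            {p : KZ.FormalPeriodRing | ∃ H : KZ.IntegralRep 1, H.domain = {t | t 0 ∈ Set.Ioo (0:ℝ) 1} ∧
              Set.EqOn H.integrand (fun t => (t 0) ^ (((3 / 4 : ℚ) : ℝ) - 1) * (1 - t 0) ^ (((1 / 2 : ℚ) : ℝ) - 1))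
                H.domain ∧ p = KZ.toFormalPeriod (KZ.of H)}))).toAddSubgroup.comap
          KZ.toFormalPeriod.toAddMonoidHom) ⊔
        (KZ.eval.ker ⊓ AddSubgroup.closure
          (({y : KZ.FormalRep | ∃ r : KZ.IntegralRep 1, KZ.IsGeodesicPolytope 0 r.domain ∧
              Set.EqOn r.integrand (KZ.hypDensity 0) r.domain ∧ y = KZ.of r} ∪
            {y | ∃ r : KZ.IntegralRep 2, KZ.IsGeodesicPolytope 1 r.domain ∧
              Set.EqOn r.integrand (KZ.hypDensity 1) r.domain ∧ y = KZ.of r} ∪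
            {y | ∃ (d : ℕ) (A : Matrix (Fin d) (Fin d) ℝ) (b : Fin d → ℝ) (r : KZ.IntegralRep d),
              (∀ j l, IsAlgebraic ℚ (A j l)) ∧ (∀ j, IsAlgebraic ℚ (b j)) ∧ A.det ≠ 0 ∧
              r.domain = (fun x => A.mulVec x + b) '' {x | (∀ i, 0 < x i) ∧ ∑ i, x i < 1} ∧
              (∀ x ∈ r.domain, r.integrand x = 1) ∧ y = KZ.of r} ∪
            {y | ∃ (A : Matrix (Fin 2) (Fin 2) ℝ) (b : Fin 2 → ℝ) (r : KZ.IntegralRep 2),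
              (∀ j l, IsAlgebraic ℚ (A j l)) ∧ (∀ j, IsAlgebraic ℚ (b j)) ∧ A.det ≠ 0 ∧
              r.domain = (fun x => A.mulVec x + b) '' {p | p 0 ^ 2 + p 1 ^ 2 < 1} ∧
              (∀ x ∈ r.domain, r.integrand x = 1) ∧ y = KZ.of r} ∪
            {y | ∃ (m : ℕ) (N : KZ.IntegralRep m), m ≤ 1 ∧ N.IsRational ∧ y = KZ.of N}) ∪
            ({y : KZ.FormalRep | ∃ (c₁ c₂ R τ₁ τ₂ : ℝ) (T : KZ.IntegralRep 2), IsAlgebraic ℚ c₁ ∧ IsAlgebraic ℚ c₂ ∧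
              IsAlgebraic ℚ R ∧ IsAlgebraic ℚ τ₁ ∧ IsAlgebraic ℚ τ₂ ∧ 0 < R ∧ R ^ 2 = 1 + c₁ ^ 2 + c₂ ^ 2 ∧ τ₁ < τ₂ ∧
              T.domain = (fun z : Fin 2 → ℝ => ![z 1 * (c₁ + R * (1 - z 0 ^ 2) / (1 + z 0 ^ 2)), z 1 * (c₂ + 2 * R * z 0 / (1 + z 0 ^ 2))]) ''
                {z | τ₁ < z 0 ∧ z 0 < τ₂ ∧ 0 < z 1 ∧ z 1 < 1} ∧
              Set.EqOn T.integrand (fun p => 4 / (1 + p 0 ^ 2 + p 1 ^ 2) ^ 2) T.domain ∧ y = KZ.of T} ∪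
            {y : KZ.FormalRep | ∃ (a b : ℂ) (c₁ c₂ R τ₁ τ₂ : ℝ) (T' : KZ.IntegralRep 2), IsAlgebraic ℚ a.re ∧ IsAlgebraic ℚ a.im ∧
              IsAlgebraic ℚ b.re ∧ IsAlgebraic ℚ b.im ∧ Complex.normSq a + Complex.normSq b = 1 ∧ IsAlgebraic ℚ c₁ ∧
              IsAlgebraic ℚ c₂ ∧ IsAlgebraic ℚ R ∧ IsAlgebraic ℚ τ₁ ∧ IsAlgebraic ℚ τ₂ ∧ 0 < R ∧ R ^ 2 = 1 + c₁ ^ 2 + c₂ ^ 2 ∧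
              τ₁ < τ₂ ∧
              (∀ p ∈ (fun z : Fin 2 → ℝ => ![z 1 * (c₁ + R * (1 - z 0 ^ 2) / (1 + z 0 ^ 2)), z 1 * (c₂ + 2 * R * z 0 / (1 + z 0 ^ 2))]) '' {z | τ₁ < z 0 ∧ z 0 < τ₂ ∧ 0 < z 1 ∧ z 1 < 1},
                -(starRingEnd ℂ b) * (((p 0 : ℝ) : ℂ) + ((p 1 : ℝ) : ℂ) * Complex.I) + starRingEnd ℂ a ≠ 0) ∧
              T'.domain = (fun p : Fin 2 → ℝ =>
            ![((a * (((p 0 : ℝ) : ℂ) + ((p 1 : ℝ) : ℂ) * Complex.I) + b) / (-(starRingEnd ℂ b) * (((p 0 : ℝ) : ℂ) + ((p 1 : ℝ) : ℂ) * Complex.I) +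
                starRingEnd ℂ a)).re,
              ((a * (((p 0 : ℝ) : ℂ) + ((p 1 : ℝ) : ℂ) * Complex.I) + b) / (-(starRingEnd ℂ b) * (((p 0 : ℝ) : ℂ) + ((p 1 : ℝ) : ℂ) * Complex.I) +
                starRingEnd ℂ a)).im]) ''
                ((fun z : Fin 2 → ℝ => ![z 1 * (c₁ + R * (1 - z 0 ^ 2) / (1 + z 0 ^ 2)), z 1 * (c₂ + 2 * R * z 0 / (1 + z 0 ^ 2))]) '' {z | τ₁ < z 0 ∧ z 0 < τ₂ ∧ 0 < z 1 ∧ z 1 < 1}) ∧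
              Set.EqOn T'.integrand (fun p => 4 / (1 + p 0 ^ 2 + p 1 ^ 2) ^ 2) T'.domain ∧ y = KZ.of T'})))) := by
  sorry

/-- Divisibility passes from the generators to the closure of the tetrahedral value-relators. [cite: DupontSah1982, §5] -/
theorem closure_tetra_divisible :
    ∀ (T : ℂ → Set (Fin 3 → ℝ)), (∀ z, T z = {p | 0 < p 1 ∧ z.re * p 1 < z.im * p 0 ∧ z.im * (p 0 - 1) < (z.re - 1) * p 1 ∧ 0 < p 2 ∧ 0 < z.im * (p 0 ^ 2 + p 1 ^ 2 + p 2 ^ 2 - p 0) + (z.re - Complex.normSq z) * p 1}) →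
    ∀ (k : ℕ), 1 ≤ k → ∀ x ∈ AddSubgroup.closure {d : KZ.FormalRep | ∃ ρ : ℂ → KZ.IntegralRep 3, (∀ z, IsAlgebraic ℚ z → 0 < z.im → (ρ z).domain = T z ∧ Set.EqOn (ρ z).integrand (fun p => 1 / p 2 ^ 3) (T z)) ∧ ∃ (k : ℕ) (z : Fin k → ℂ) (n : Fin k → ℤ), (∀ i, IsAlgebraic ℚ (z i)) ∧ (∀ i, 0 < (z i).im) ∧ ∑ i, (n i : ℝ) * (ρ (z i)).value = 0 ∧ d = ∑ i, n i • KZ.of (ρ (z i))},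
      ∃ y ∈ AddSubgroup.closure {d : KZ.FormalRep | ∃ ρ : ℂ → KZ.IntegralRep 3, (∀ z, IsAlgebraic ℚ z → 0 < z.im → (ρ z).domain = T z ∧ Set.EqOn (ρ z).integrand (fun p => 1 / p 2 ^ 3) (T z)) ∧ ∃ (k : ℕ) (z : Fin k → ℂ) (n : Fin k → ℤ), (∀ i, IsAlgebraic ℚ (z i)) ∧ (∀ i, 0 < (z i).im) ∧ ∑ i, (n i : ℝ) * (ρ (z i)).value = 0 ∧ d = ∑ i, n i • KZ.of (ρ (z i))}, x - k • y ∈ KZ.relations := by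
  intro T hT k hk x hx
  induction hx using AddSubgroup.closure_induction with
  | mem d hd =>
    obtain ⟨d', hd', h⟩ := stub_oracleDivisible T hT k hk d hd
    exact ⟨d', AddSubgroup.subset_closure hd', h⟩
  | zero => exact ⟨0, zero_mem _, by rw [smul_zero, sub_zero]; exact zero_mem _⟩
  | add x y _ _ hx hy =>
    obtain ⟨x', hx', hxx⟩ := hx
    obtain ⟨y', hy', hyy⟩ := hy
    refine ⟨x' + y', add_mem hx' hy', ?_⟩
    have : x + y - k • (x' + y') = (x - k • x') + (y - k • y') := by rw [smul_add]; abel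
    rw [this]
    exact add_mem hxx hyy
  | neg x _ hx =>
    obtain ⟨x', hx', hxx⟩ := hx
    refine ⟨-x', neg_mem hx', ?_⟩
    have : -x - k • (-x') = -(x - k • x') := by rw [smul_neg]; abel
    rw [this]
    exact neg_mem hxx

/-- **`FormalRep ⧸ (relations ⊔ closure tetraRelators)` IS TORSION-FREE** (Disproof §6 `not_of_torsion` closed
unconditionally): if a positive multiple of `c` lies in the target subgroup of the crux, so does `c` — the oracle is divisible
modulo relations (`closure_tetra_divisible`) and `FormalRep ⧸ relations` is torsion-free
(`BetaCancellationNegative.mem_relations_of_nsmul_mem`). [cite: DupontSah1982, §5] -/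
theorem torsionFree_sup_closure_tetra :
    ∀ (T : ℂ → Set (Fin 3 → ℝ)), (∀ z, T z = {p | 0 < p 1 ∧ z.re * p 1 < z.im * p 0 ∧ z.im * (p 0 - 1) < (z.re - 1) * p 1 ∧ 0 < p 2 ∧ 0 < z.im * (p 0 ^ 2 + p 1 ^ 2 + p 2 ^ 2 - p 0) + (z.re - Complex.normSq z) * p 1}) →
    ∀ (k : ℕ), k ≠ 0 → ∀ c : KZ.FormalRep,
      k • c ∈ KZ.relations ⊔ AddSubgroup.closure {d : KZ.FormalRep | ∃ ρ : ℂ → KZ.IntegralRep 3, (∀ z, IsAlgebraic ℚ z → 0 < z.im → (ρ z).domain = T z ∧ Set.EqOn (ρ z).integrand (fun p => 1 / p 2 ^ 3) (T z)) ∧ ∃ (k : ℕ) (z : Fin k → ℂ) (n : Fin k → ℤ), (∀ i, IsAlgebraic ℚ (z i)) ∧ (∀ i, 0 < (z i).im) ∧ ∑ i, (n i : ℝ) * (ρ (z i)).value = 0 ∧ d = ∑ i, n i • KZ.of (ρ (z i))} →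
      c ∈ KZ.relations ⊔ AddSubgroup.closure {d : KZ.FormalRep | ∃ ρ : ℂ → KZ.IntegralRep 3, (∀ z, IsAlgebraic ℚ z → 0 < z.im → (ρ z).domain = T z ∧ Set.EqOn (ρ z).integrand (fun p => 1 / p 2 ^ 3) (T z)) ∧ ∃ (k : ℕ) (z : Fin k → ℂ) (n : Fin k → ℤ), (∀ i, IsAlgebraic ℚ (z i)) ∧ (∀ i, 0 < (z i).im) ∧ ∑ i, (n i : ℝ) * (ρ (z i)).value = 0 ∧ d = ∑ i, n i • KZ.of (ρ (z i))} := by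
  intro T hT k hk c hc
  obtain ⟨r, hr, t, ht, hrt⟩ := AddSubgroup.mem_sup.mp hc
  obtain ⟨t', ht', htt⟩ := closure_tetra_divisible T hT k (Nat.one_le_iff_ne_zero.mpr hk) t ht
  have hk' : k • (c - t') ∈ KZ.relations := by
    have : k • (c - t') = r + (t - k • t') := by rw [smul_sub, ← hrt]; abel
    rw [this]
    exact add_mem hr htt
  have hct : c - t' ∈ KZ.relations :=
    Summit.KontsevichZagierPeriods.KontsevichZagierPeriods.BetaCancellationNegative.mem_relations_of_nsmul_mem hk hk'
  have : c = (c - t') + t' := by abel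
  rw [this]
  exact add_mem (AddSubgroup.mem_sup_left hct) (AddSubgroup.mem_sup_right ht')

/-- **The crux is equivalent to its `ℚ`-form** (certificates for a positive multiple suffice).
[cite: KontsevichZagier2001, §1.2] -/
theorem offTetraSectorKernel_iff_rationalForm :
    Summit.KontsevichZagierPeriods.KontsevichZagierPeriods.Theses.HyperbolicBloch.OffTetraSectorKernel ↔
    (∀ (T : ℂ → Set (Fin 3 → ℝ)), (∀ z, T z = {p | 0 < p 1 ∧ z.re * p 1 < z.im * p 0 ∧ z.im * (p 0 - 1) < (z.re - 1) * p 1 ∧ 0 < p 2 ∧ 0 < z.im * (p 0 ^ 2 + p 1 ^ 2 + p 2 ^ 2 - p 0) + (z.re - Complex.normSq z) * p 1}) →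
      ∀ c : KZ.FormalRep, KZ.eval c = 0 → ∃ N : ℕ, N ≠ 0 ∧
        N • c ∈ KZ.relations ⊔ AddSubgroup.closure {d : KZ.FormalRep | ∃ ρ : ℂ → KZ.IntegralRep 3, (∀ z, IsAlgebraic ℚ z → 0 < z.im → (ρ z).domain = T z ∧ Set.EqOn (ρ z).integrand (fun p => 1 / p 2 ^ 3) (T z)) ∧ ∃ (k : ℕ) (z : Fin k → ℂ) (n : Fin k → ℤ), (∀ i, IsAlgebraic ℚ (z i)) ∧ (∀ i, 0 < (z i).im) ∧ ∑ i, (n i : ℝ) * (ρ (z i)).value = 0 ∧ d = ∑ i, n i • KZ.of (ρ (z i))}) := by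
  constructor
  · intro h T hT c hc
    exact ⟨1, one_ne_zero, by rw [one_smul]; exact h T hT c hc⟩
  · intro h T hT c hc
    obtain ⟨N, hN, hNc⟩ := h T hT c hc
    exact torsionFree_sup_closure_tetra T hT N hN c hNc

/-- COMPOSITION (sorry-free modulo the stubs). Let `S = relations ⊔ closure tetra` and `W` the remainder's oracle. The
saturation `Wq = {x | ∃ N ≠ 0, N • x ∈ relations ⊔ W}` is a subgroup; the `ℚ`-Moser remainder says `[G] − [Q] ∈ Wq`, so the
oracle-generic transfer chain (`stub_cubeDensityTransfer`, `stub_valueOneOfOrbit`, `stub_kernelOfValueOne`, all landed, at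
the oracle `Wq`) gives `c ∈ relations ⊔ Wq`; every adjoined sector of `W` lies in `S` (rung 2: `rungTwo_le`; envelope:
Baker; affine sector; Lindemann / Chudnovsky / one-log / equianharmonic / Legendre rings; spherical rung 1), so
`relations ⊔ W ≤ S`, and `Wq ≤ S` by TORSION-FREENESS of `FormalRep ⧸ S` (`torsionFree_sup_closure_tetra`). -/
theorem OffTetraSectorKernel_of :
    Summit.KontsevichZagierPeriods.KontsevichZagierPeriods.Theses.HyperbolicBloch.OffTetraSectorKernel := by
  intro T hT c hc
  -- the remainder's oracle lies in the target subgroup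
  have hWS : KZ.relations ⊔ (AddSubgroup.closure {d : KZ.FormalRep | ∃ ρ : ℂ → KZ.IntegralRep 3,
          (∀ z, IsAlgebraic ℚ z → 0 < z.im → (ρ z).domain = T z ∧
            Set.EqOn (ρ z).integrand (fun p => 1 / p 2 ^ 3) (T z)) ∧
          ∃ (k : ℕ) (z : Fin k → ℂ) (n : Fin k → ℤ), (∀ i, IsAlgebraic ℚ (z i)) ∧ (∀ i, 0 < (z i).im) ∧
            ∑ i, (n i : ℝ) * (ρ (z i)).value = 0 ∧ d = ∑ i, n i • KZ.of (ρ (z i))} ⊔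
        AddSubgroup.closure (KZ.rungRelators 2) ⊔
        (KZ.eval.ker ⊓ AddSubgroup.closure
          ({y : KZ.FormalRep | ∃ r : KZ.IntegralRep 1, KZ.IsGeodesicPolytope 0 r.domain ∧
              Set.EqOn r.integrand (KZ.hypDensity 0) r.domain ∧ y = KZ.of r} ∪
            {y | ∃ r : KZ.IntegralRep 2, KZ.IsGeodesicPolytope 1 r.domain ∧
              Set.EqOn r.integrand (KZ.hypDensity 1) r.domain ∧ y = KZ.of r} ∪
            {y | ∃ (d : ℕ) (A : Matrix (Fin d) (Fin d) ℝ) (b : Fin d → ℝ) (r : KZ.IntegralRep d),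
              (∀ j l, IsAlgebraic ℚ (A j l)) ∧ (∀ j, IsAlgebraic ℚ (b j)) ∧ A.det ≠ 0 ∧
              r.domain = (fun x => A.mulVec x + b) '' {x | (∀ i, 0 < x i) ∧ ∑ i, x i < 1} ∧
              (∀ x ∈ r.domain, r.integrand x = 1) ∧ y = KZ.of r} ∪
            {y | ∃ (A : Matrix (Fin 2) (Fin 2) ℝ) (b : Fin 2 → ℝ) (r : KZ.IntegralRep 2),
              (∀ j l, IsAlgebraic ℚ (A j l)) ∧ (∀ j, IsAlgebraic ℚ (b j)) ∧ A.det ≠ 0 ∧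
              r.domain = (fun x => A.mulVec x + b) '' {p | p 0 ^ 2 + p 1 ^ 2 < 1} ∧
              (∀ x ∈ r.domain, r.integrand x = 1) ∧ y = KZ.of r} ∪
            {y | ∃ (m : ℕ) (N : KZ.IntegralRep m), m ≤ 1 ∧ N.IsRational ∧ y = KZ.of N})) ⊔
        AddSubgroup.closure {c : KZ.FormalRep | ∃ (d k : ℕ) (B : Set (Fin d → ℝ))
          (A : Fin k → Matrix (Fin d) (Fin d) ℝ) (b : Fin k → Fin d → ℝ) (m : Fin k → ℤ)
          (r : Fin k → KZ.IntegralRep d), Literature.ModelTheory.ExponentialFields.IsSemialgebraic ℚ B ∧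
          volume B ≠ ⊤ ∧ (∀ i j l, IsAlgebraic ℚ (A i j l)) ∧ (∀ i j, IsAlgebraic ℚ (b i j)) ∧
          (∀ i, (A i).det ≠ 0) ∧ (∀ i, (r i).domain = (fun x => (A i).mulVec x + b i) '' B) ∧
          (∀ i, ∀ x ∈ (r i).domain, (r i).integrand x = 1) ∧ ∑ i, (m i : ℝ) * (r i).value = 0 ∧
          c = ∑ i, m i • KZ.of (r i)} ⊔
        (KZ.eval.ker ⊓ (Subring.closure
          ({p : KZ.FormalPeriodRing | ∃ (a : ℝ) (ha : IsAlgebraic ℚ a),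
              p = KZ.toFormalPeriod (KZ.of (KZ.IntegralRep.unit.constMul a ha))} ∪
            {p : KZ.FormalPeriodRing | ∃ A : KZ.IntegralRep 1, A.domain = {t | t 0 ∈ Set.Ioo (0:ℝ) 1} ∧
              Set.EqOn A.integrand (fun t => 1 / (1 + t 0 ^ 2)) A.domain ∧
              p = KZ.toFormalPeriod (KZ.of A)})).toAddSubgroup.comap
          KZ.toFormalPeriod.toAddMonoidHom) ⊔
        (KZ.eval.ker ⊓ (Subring.closure
          ({p : KZ.FormalPeriodRing | ∃ (a : ℝ) (ha : IsAlgebraic ℚ a),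
              p = KZ.toFormalPeriod (KZ.of (KZ.IntegralRep.unit.constMul a ha))} ∪
            ({p : KZ.FormalPeriodRing | ∃ A : KZ.IntegralRep 1, A.domain = {t | t 0 ∈ Set.Ioo (0:ℝ) 1} ∧
              Set.EqOn A.integrand (fun t => 1 / (1 + t 0 ^ 2)) A.domain ∧ p = KZ.toFormalPeriod (KZ.of A)} ∪
            {p : KZ.FormalPeriodRing | ∃ H : KZ.IntegralRep 1, H.domain = {t | t 0 ∈ Set.Ioo (0:ℝ) 1} ∧
              Set.EqOn H.integrand (fun t => (t 0) ^ (((1 / 4 : ℚ) : ℝ) - 1) * (1 - t 0) ^ (((1 / 2 : ℚ) : ℝ) - 1))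
                H.domain ∧ p = KZ.toFormalPeriod (KZ.of H)}))).toAddSubgroup.comap
          KZ.toFormalPeriod.toAddMonoidHom) ⊔
        AddSubgroup.closure {c : KZ.FormalRep | ∃ a : ℝ, IsAlgebraic ℚ a ∧ 1 < a ∧ KZ.eval c = 0 ∧
          KZ.toFormalPeriod c ∈ Subring.closure
            ({p : KZ.FormalPeriodRing | ∃ (c : ℝ) (hc : IsAlgebraic ℚ c),
                p = KZ.toFormalPeriod (KZ.of (KZ.IntegralRep.unit.constMul c hc))} ∪
              {p : KZ.FormalPeriodRing | ∃ Λ : KZ.IntegralRep 1, Λ.domain = {t | 1 < t 0 ∧ t 0 < a} ∧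
                Set.EqOn Λ.integrand (fun t => 1 / t 0) Λ.domain ∧ p = KZ.toFormalPeriod (KZ.of Λ)})} ⊔
        (KZ.eval.ker ⊓ (Subring.closure
          ({p : KZ.FormalPeriodRing | ∃ (a : ℝ) (ha : IsAlgebraic ℚ a),
              p = KZ.toFormalPeriod (KZ.of (KZ.IntegralRep.unit.constMul a ha))} ∪
            ({p : KZ.FormalPeriodRing | ∃ A : KZ.IntegralRep 1, A.domain = {t | t 0 ∈ Set.Ioo (0:ℝ) 1} ∧
              Set.EqOn A.integrand (fun t => 1 / (1 + t 0 ^ 2)) A.domain ∧ p = KZ.toFormalPeriod (KZ.of A)} ∪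
            {p : KZ.FormalPeriodRing | ∃ H : KZ.IntegralRep 1, H.domain = {t | t 0 ∈ Set.Ioo (0:ℝ) 1} ∧
              Set.EqOn H.integrand (fun t => (t 0) ^ (((1 / 3 : ℚ) : ℝ) - 1) * (1 - t 0) ^ (((1 / 3 : ℚ) : ℝ) - 1))
                H.domain ∧ p = KZ.toFormalPeriod (KZ.of H)}))).toAddSubgroup.comap
          KZ.toFormalPeriod.toAddMonoidHom) ⊔
        (KZ.eval.ker ⊓ (Subring.closure
          ({p : KZ.FormalPeriodRing | ∃ (a : ℝ) (ha : IsAlgebraic ℚ a),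
              p = KZ.toFormalPeriod (KZ.of (KZ.IntegralRep.unit.constMul a ha))} ∪
            ({p : KZ.FormalPeriodRing | ∃ A : KZ.IntegralRep 1, A.domain = {t | t 0 ∈ Set.Ioo (0:ℝ) 1} ∧
              Set.EqOn A.integrand (fun t => 1 / (1 + t 0 ^ 2)) A.domain ∧ p = KZ.toFormalPeriod (KZ.of A)} ∪
            {p : KZ.FormalPeriodRing | ∃ H : KZ.IntegralRep 1, H.domain = {t | t 0 ∈ Set.Ioo (0:ℝ) 1} ∧
              Set.EqOn H.integrand (fun t => (t 0) ^ (((1 / 4 : ℚ) : ℝ) - 1) * (1 - t 0) ^ (((1 / 2 : ℚ) : ℝ) - 1))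
                H.domain ∧ p = KZ.toFormalPeriod (KZ.of H)} ∪
            {p : KZ.FormalPeriodRing | ∃ H : KZ.IntegralRep 1, H.domain = {t | t 0 ∈ Set.Ioo (0:ℝ) 1} ∧
              Set.EqOn H.integrand (fun t => (t 0) ^ (((3 / 4 : ℚ) : ℝ) - 1) * (1 - t 0) ^ (((1 / 2 : ℚ) : ℝ) - 1))
                H.domain ∧ p = KZ.toFormalPeriod (KZ.of H)}))).toAddSubgroup.comap
          KZ.toFormalPeriod.toAddMonoidHom) ⊔
        (KZ.eval.ker ⊓ AddSubgroup.closure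
          (({y : KZ.FormalRep | ∃ r : KZ.IntegralRep 1, KZ.IsGeodesicPolytope 0 r.domain ∧
              Set.EqOn r.integrand (KZ.hypDensity 0) r.domain ∧ y = KZ.of r} ∪
            {y | ∃ r : KZ.IntegralRep 2, KZ.IsGeodesicPolytope 1 r.domain ∧
              Set.EqOn r.integrand (KZ.hypDensity 1) r.domain ∧ y = KZ.of r} ∪
            {y | ∃ (d : ℕ) (A : Matrix (Fin d) (Fin d) ℝ) (b : Fin d → ℝ) (r : KZ.IntegralRep d),
              (∀ j l, IsAlgebraic ℚ (A j l)) ∧ (∀ j, IsAlgebraic ℚ (b j)) ∧ A.det ≠ 0 ∧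
              r.domain = (fun x => A.mulVec x + b) '' {x | (∀ i, 0 < x i) ∧ ∑ i, x i < 1} ∧
              (∀ x ∈ r.domain, r.integrand x = 1) ∧ y = KZ.of r} ∪
            {y | ∃ (A : Matrix (Fin 2) (Fin 2) ℝ) (b : Fin 2 → ℝ) (r : KZ.IntegralRep 2),
              (∀ j l, IsAlgebraic ℚ (A j l)) ∧ (∀ j, IsAlgebraic ℚ (b j)) ∧ A.det ≠ 0 ∧
              r.domain = (fun x => A.mulVec x + b) '' {p | p 0 ^ 2 + p 1 ^ 2 < 1} ∧
              (∀ x ∈ r.domain, r.integrand x = 1) ∧ y = KZ.of r} ∪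
            {y | ∃ (m : ℕ) (N : KZ.IntegralRep m), m ≤ 1 ∧ N.IsRational ∧ y = KZ.of N}) ∪
            ({y : KZ.FormalRep | ∃ (c₁ c₂ R τ₁ τ₂ : ℝ) (T : KZ.IntegralRep 2), IsAlgebraic ℚ c₁ ∧ IsAlgebraic ℚ c₂ ∧
              IsAlgebraic ℚ R ∧ IsAlgebraic ℚ τ₁ ∧ IsAlgebraic ℚ τ₂ ∧ 0 < R ∧ R ^ 2 = 1 + c₁ ^ 2 + c₂ ^ 2 ∧ τ₁ < τ₂ ∧
              T.domain = (fun z : Fin 2 → ℝ => ![z 1 * (c₁ + R * (1 - z 0 ^ 2) / (1 + z 0 ^ 2)), z 1 * (c₂ + 2 * R * z 0 / (1 + z 0 ^ 2))]) ''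
                {z | τ₁ < z 0 ∧ z 0 < τ₂ ∧ 0 < z 1 ∧ z 1 < 1} ∧
              Set.EqOn T.integrand (fun p => 4 / (1 + p 0 ^ 2 + p 1 ^ 2) ^ 2) T.domain ∧ y = KZ.of T} ∪
            {y : KZ.FormalRep | ∃ (a b : ℂ) (c₁ c₂ R τ₁ τ₂ : ℝ) (T' : KZ.IntegralRep 2), IsAlgebraic ℚ a.re ∧ IsAlgebraic ℚ a.im ∧
              IsAlgebraic ℚ b.re ∧ IsAlgebraic ℚ b.im ∧ Complex.normSq a + Complex.normSq b = 1 ∧ IsAlgebraic ℚ c₁ ∧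
              IsAlgebraic ℚ c₂ ∧ IsAlgebraic ℚ R ∧ IsAlgebraic ℚ τ₁ ∧ IsAlgebraic ℚ τ₂ ∧ 0 < R ∧ R ^ 2 = 1 + c₁ ^ 2 + c₂ ^ 2 ∧
              τ₁ < τ₂ ∧
              (∀ p ∈ (fun z : Fin 2 → ℝ => ![z 1 * (c₁ + R * (1 - z 0 ^ 2) / (1 + z 0 ^ 2)), z 1 * (c₂ + 2 * R * z 0 / (1 + z 0 ^ 2))]) '' {z | τ₁ < z 0 ∧ z 0 < τ₂ ∧ 0 < z 1 ∧ z 1 < 1},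
                -(starRingEnd ℂ b) * (((p 0 : ℝ) : ℂ) + ((p 1 : ℝ) : ℂ) * Complex.I) + starRingEnd ℂ a ≠ 0) ∧
              T'.domain = (fun p : Fin 2 → ℝ =>
            ![((a * (((p 0 : ℝ) : ℂ) + ((p 1 : ℝ) : ℂ) * Complex.I) + b) / (-(starRingEnd ℂ b) * (((p 0 : ℝ) : ℂ) + ((p 1 : ℝ) : ℂ) * Complex.I) +
                starRingEnd ℂ a)).re,
              ((a * (((p 0 : ℝ) : ℂ) + ((p 1 : ℝ) : ℂ) * Complex.I) + b) / (-(starRingEnd ℂ b) * (((p 0 : ℝ) : ℂ) + ((p 1 : ℝ) : ℂ) * Complex.I) +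
                starRingEnd ℂ a)).im]) ''
                ((fun z : Fin 2 → ℝ => ![z 1 * (c₁ + R * (1 - z 0 ^ 2) / (1 + z 0 ^ 2)), z 1 * (c₂ + 2 * R * z 0 / (1 + z 0 ^ 2))]) '' {z | τ₁ < z 0 ∧ z 0 < τ₂ ∧ 0 < z 1 ∧ z 1 < 1}) ∧
              Set.EqOn T'.integrand (fun p => 4 / (1 + p 0 ^ 2 + p 1 ^ 2) ^ 2) T'.domain ∧ y = KZ.of T'})))) ≤ KZ.relations ⊔ AddSubgroup.closure {d : KZ.FormalRep | ∃ ρ : ℂ → KZ.IntegralRep 3, (∀ z, IsAlgebraic ℚ z → 0 < z.im → (ρ z).domain = T z ∧ Set.EqOn (ρ z).integrand (fun p => 1 / p 2 ^ 3) (T z)) ∧ ∃ (k : ℕ) (z : Fin k → ℂ) (n : Fin k → ℤ), (∀ i, IsAlgebraic ℚ (z i)) ∧ (∀ i, 0 < (z i).im) ∧ ∑ i, (n i : ℝ) * (ρ (z i)).value = 0 ∧ d = ∑ i, n i • KZ.of (ρ (z i))} :=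
    sup_le le_sup_left (sup_le (sup_le (sup_le (sup_le (sup_le (sup_le (sup_le (sup_le (sup_le le_sup_right
      (rungTwo_le T hT))
      (bakerEnvelope_inf_ker_le_relations.trans le_sup_left))
      (closure_affineOrbit_le_relations.trans le_sup_left))
      (lindemannRing_inf_ker_le_relations.trans le_sup_left))
      (chudnovskyRing_inf_ker_le_relations.trans le_sup_left))
      (((AddSubgroup.closure_le _).mpr (by
        rintro x ⟨a, ha, h1, hx0, hxS⟩
        exact hermiteLindemannRing_inf_ker_le_relations ha h1 ⟨hx0, hxS⟩)).trans le_sup_left))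
      (equianharmonicRing_inf_ker_le_relations.trans le_sup_left))
      (legendreRing_inf_ker_le_relations.trans le_sup_left))
      (sphericalRungOne_inf_ker_le_relations.trans le_sup_left))
  -- the saturation of `relations ⊔ W`
  let Wq : AddSubgroup KZ.FormalRep :=
    { carrier := {x | ∃ N : ℕ, N ≠ 0 ∧ N • x ∈ KZ.relations ⊔ (AddSubgroup.closure {d : KZ.FormalRep | ∃ ρ : ℂ → KZ.IntegralRep 3,
          (∀ z, IsAlgebraic ℚ z → 0 < z.im → (ρ z).domain = T z ∧
            Set.EqOn (ρ z).integrand (fun p => 1 / p 2 ^ 3) (T z)) ∧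
          ∃ (k : ℕ) (z : Fin k → ℂ) (n : Fin k → ℤ), (∀ i, IsAlgebraic ℚ (z i)) ∧ (∀ i, 0 < (z i).im) ∧
            ∑ i, (n i : ℝ) * (ρ (z i)).value = 0 ∧ d = ∑ i, n i • KZ.of (ρ (z i))} ⊔
        AddSubgroup.closure (KZ.rungRelators 2) ⊔
        (KZ.eval.ker ⊓ AddSubgroup.closure
          ({y : KZ.FormalRep | ∃ r : KZ.IntegralRep 1, KZ.IsGeodesicPolytope 0 r.domain ∧
              Set.EqOn r.integrand (KZ.hypDensity 0) r.domain ∧ y = KZ.of r} ∪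
            {y | ∃ r : KZ.IntegralRep 2, KZ.IsGeodesicPolytope 1 r.domain ∧
              Set.EqOn r.integrand (KZ.hypDensity 1) r.domain ∧ y = KZ.of r} ∪
            {y | ∃ (d : ℕ) (A : Matrix (Fin d) (Fin d) ℝ) (b : Fin d → ℝ) (r : KZ.IntegralRep d),
              (∀ j l, IsAlgebraic ℚ (A j l)) ∧ (∀ j, IsAlgebraic ℚ (b j)) ∧ A.det ≠ 0 ∧
              r.domain = (fun x => A.mulVec x + b) '' {x | (∀ i, 0 < x i) ∧ ∑ i, x i < 1} ∧
              (∀ x ∈ r.domain, r.integrand x = 1) ∧ y = KZ.of r} ∪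
            {y | ∃ (A : Matrix (Fin 2) (Fin 2) ℝ) (b : Fin 2 → ℝ) (r : KZ.IntegralRep 2),
              (∀ j l, IsAlgebraic ℚ (A j l)) ∧ (∀ j, IsAlgebraic ℚ (b j)) ∧ A.det ≠ 0 ∧
              r.domain = (fun x => A.mulVec x + b) '' {p | p 0 ^ 2 + p 1 ^ 2 < 1} ∧
              (∀ x ∈ r.domain, r.integrand x = 1) ∧ y = KZ.of r} ∪
            {y | ∃ (m : ℕ) (N : KZ.IntegralRep m), m ≤ 1 ∧ N.IsRational ∧ y = KZ.of N})) ⊔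
        AddSubgroup.closure {c : KZ.FormalRep | ∃ (d k : ℕ) (B : Set (Fin d → ℝ))
          (A : Fin k → Matrix (Fin d) (Fin d) ℝ) (b : Fin k → Fin d → ℝ) (m : Fin k → ℤ)
          (r : Fin k → KZ.IntegralRep d), Literature.ModelTheory.ExponentialFields.IsSemialgebraic ℚ B ∧
          volume B ≠ ⊤ ∧ (∀ i j l, IsAlgebraic ℚ (A i j l)) ∧ (∀ i j, IsAlgebraic ℚ (b i j)) ∧
          (∀ i, (A i).det ≠ 0) ∧ (∀ i, (r i).domain = (fun x => (A i).mulVec x + b i) '' B) ∧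
          (∀ i, ∀ x ∈ (r i).domain, (r i).integrand x = 1) ∧ ∑ i, (m i : ℝ) * (r i).value = 0 ∧
          c = ∑ i, m i • KZ.of (r i)} ⊔
        (KZ.eval.ker ⊓ (Subring.closure
          ({p : KZ.FormalPeriodRing | ∃ (a : ℝ) (ha : IsAlgebraic ℚ a),
              p = KZ.toFormalPeriod (KZ.of (KZ.IntegralRep.unit.constMul a ha))} ∪
            {p : KZ.FormalPeriodRing | ∃ A : KZ.IntegralRep 1, A.domain = {t | t 0 ∈ Set.Ioo (0:ℝ) 1} ∧
              Set.EqOn A.integrand (fun t => 1 / (1 + t 0 ^ 2)) A.domain ∧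
              p = KZ.toFormalPeriod (KZ.of A)})).toAddSubgroup.comap
          KZ.toFormalPeriod.toAddMonoidHom) ⊔
        (KZ.eval.ker ⊓ (Subring.closure
          ({p : KZ.FormalPeriodRing | ∃ (a : ℝ) (ha : IsAlgebraic ℚ a),
              p = KZ.toFormalPeriod (KZ.of (KZ.IntegralRep.unit.constMul a ha))} ∪
            ({p : KZ.FormalPeriodRing | ∃ A : KZ.IntegralRep 1, A.domain = {t | t 0 ∈ Set.Ioo (0:ℝ) 1} ∧
              Set.EqOn A.integrand (fun t => 1 / (1 + t 0 ^ 2)) A.domain ∧ p = KZ.toFormalPeriod (KZ.of A)} ∪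
            {p : KZ.FormalPeriodRing | ∃ H : KZ.IntegralRep 1, H.domain = {t | t 0 ∈ Set.Ioo (0:ℝ) 1} ∧
              Set.EqOn H.integrand (fun t => (t 0) ^ (((1 / 4 : ℚ) : ℝ) - 1) * (1 - t 0) ^ (((1 / 2 : ℚ) : ℝ) - 1))
                H.domain ∧ p = KZ.toFormalPeriod (KZ.of H)}))).toAddSubgroup.comap
          KZ.toFormalPeriod.toAddMonoidHom) ⊔
        AddSubgroup.closure {c : KZ.FormalRep | ∃ a : ℝ, IsAlgebraic ℚ a ∧ 1 < a ∧ KZ.eval c = 0 ∧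
          KZ.toFormalPeriod c ∈ Subring.closure
            ({p : KZ.FormalPeriodRing | ∃ (c : ℝ) (hc : IsAlgebraic ℚ c),
                p = KZ.toFormalPeriod (KZ.of (KZ.IntegralRep.unit.constMul c hc))} ∪
              {p : KZ.FormalPeriodRing | ∃ Λ : KZ.IntegralRep 1, Λ.domain = {t | 1 < t 0 ∧ t 0 < a} ∧
                Set.EqOn Λ.integrand (fun t => 1 / t 0) Λ.domain ∧ p = KZ.toFormalPeriod (KZ.of Λ)})} ⊔
        (KZ.eval.ker ⊓ (Subring.closure
          ({p : KZ.FormalPeriodRing | ∃ (a : ℝ) (ha : IsAlgebraic ℚ a),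
              p = KZ.toFormalPeriod (KZ.of (KZ.IntegralRep.unit.constMul a ha))} ∪
            ({p : KZ.FormalPeriodRing | ∃ A : KZ.IntegralRep 1, A.domain = {t | t 0 ∈ Set.Ioo (0:ℝ) 1} ∧
              Set.EqOn A.integrand (fun t => 1 / (1 + t 0 ^ 2)) A.domain ∧ p = KZ.toFormalPeriod (KZ.of A)} ∪
            {p : KZ.FormalPeriodRing | ∃ H : KZ.IntegralRep 1, H.domain = {t | t 0 ∈ Set.Ioo (0:ℝ) 1} ∧
              Set.EqOn H.integrand (fun t => (t 0) ^ (((1 / 3 : ℚ) : ℝ) - 1) * (1 - t 0) ^ (((1 / 3 : ℚ) : ℝ) - 1))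
                H.domain ∧ p = KZ.toFormalPeriod (KZ.of H)}))).toAddSubgroup.comap
          KZ.toFormalPeriod.toAddMonoidHom) ⊔
        (KZ.eval.ker ⊓ (Subring.closure
          ({p : KZ.FormalPeriodRing | ∃ (a : ℝ) (ha : IsAlgebraic ℚ a),
              p = KZ.toFormalPeriod (KZ.of (KZ.IntegralRep.unit.constMul a ha))} ∪
            ({p : KZ.FormalPeriodRing | ∃ A : KZ.IntegralRep 1, A.domain = {t | t 0 ∈ Set.Ioo (0:ℝ) 1} ∧
              Set.EqOn A.integrand (fun t => 1 / (1 + t 0 ^ 2)) A.domain ∧ p = KZ.toFormalPeriod (KZ.of A)} ∪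
            {p : KZ.FormalPeriodRing | ∃ H : KZ.IntegralRep 1, H.domain = {t | t 0 ∈ Set.Ioo (0:ℝ) 1} ∧
              Set.EqOn H.integrand (fun t => (t 0) ^ (((1 / 4 : ℚ) : ℝ) - 1) * (1 - t 0) ^ (((1 / 2 : ℚ) : ℝ) - 1))
                H.domain ∧ p = KZ.toFormalPeriod (KZ.of H)} ∪
            {p : KZ.FormalPeriodRing | ∃ H : KZ.IntegralRep 1, H.domain = {t | t 0 ∈ Set.Ioo (0:ℝ) 1} ∧
              Set.EqOn H.integrand (fun t => (t 0) ^ (((3 / 4 : ℚ) : ℝ) - 1) * (1 - t 0) ^ (((1 / 2 : ℚ) : ℝ) - 1))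
                H.domain ∧ p = KZ.toFormalPeriod (KZ.of H)}))).toAddSubgroup.comap
          KZ.toFormalPeriod.toAddMonoidHom) ⊔
        (KZ.eval.ker ⊓ AddSubgroup.closure
          (({y : KZ.FormalRep | ∃ r : KZ.IntegralRep 1, KZ.IsGeodesicPolytope 0 r.domain ∧
              Set.EqOn r.integrand (KZ.hypDensity 0) r.domain ∧ y = KZ.of r} ∪
            {y | ∃ r : KZ.IntegralRep 2, KZ.IsGeodesicPolytope 1 r.domain ∧
              Set.EqOn r.integrand (KZ.hypDensity 1) r.domain ∧ y = KZ.of r} ∪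
            {y | ∃ (d : ℕ) (A : Matrix (Fin d) (Fin d) ℝ) (b : Fin d → ℝ) (r : KZ.IntegralRep d),
              (∀ j l, IsAlgebraic ℚ (A j l)) ∧ (∀ j, IsAlgebraic ℚ (b j)) ∧ A.det ≠ 0 ∧
              r.domain = (fun x => A.mulVec x + b) '' {x | (∀ i, 0 < x i) ∧ ∑ i, x i < 1} ∧
              (∀ x ∈ r.domain, r.integrand x = 1) ∧ y = KZ.of r} ∪
            {y | ∃ (A : Matrix (Fin 2) (Fin 2) ℝ) (b : Fin 2 → ℝ) (r : KZ.IntegralRep 2),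
              (∀ j l, IsAlgebraic ℚ (A j l)) ∧ (∀ j, IsAlgebraic ℚ (b j)) ∧ A.det ≠ 0 ∧
              r.domain = (fun x => A.mulVec x + b) '' {p | p 0 ^ 2 + p 1 ^ 2 < 1} ∧
              (∀ x ∈ r.domain, r.integrand x = 1) ∧ y = KZ.of r} ∪
            {y | ∃ (m : ℕ) (N : KZ.IntegralRep m), m ≤ 1 ∧ N.IsRational ∧ y = KZ.of N}) ∪
            ({y : KZ.FormalRep | ∃ (c₁ c₂ R τ₁ τ₂ : ℝ) (T : KZ.IntegralRep 2), IsAlgebraic ℚ c₁ ∧ IsAlgebraic ℚ c₂ ∧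
              IsAlgebraic ℚ R ∧ IsAlgebraic ℚ τ₁ ∧ IsAlgebraic ℚ τ₂ ∧ 0 < R ∧ R ^ 2 = 1 + c₁ ^ 2 + c₂ ^ 2 ∧ τ₁ < τ₂ ∧
              T.domain = (fun z : Fin 2 → ℝ => ![z 1 * (c₁ + R * (1 - z 0 ^ 2) / (1 + z 0 ^ 2)), z 1 * (c₂ + 2 * R * z 0 / (1 + z 0 ^ 2))]) ''
                {z | τ₁ < z 0 ∧ z 0 < τ₂ ∧ 0 < z 1 ∧ z 1 < 1} ∧
              Set.EqOn T.integrand (fun p => 4 / (1 + p 0 ^ 2 + p 1 ^ 2) ^ 2) T.domain ∧ y = KZ.of T} ∪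
            {y : KZ.FormalRep | ∃ (a b : ℂ) (c₁ c₂ R τ₁ τ₂ : ℝ) (T' : KZ.IntegralRep 2), IsAlgebraic ℚ a.re ∧ IsAlgebraic ℚ a.im ∧
              IsAlgebraic ℚ b.re ∧ IsAlgebraic ℚ b.im ∧ Complex.normSq a + Complex.normSq b = 1 ∧ IsAlgebraic ℚ c₁ ∧
              IsAlgebraic ℚ c₂ ∧ IsAlgebraic ℚ R ∧ IsAlgebraic ℚ τ₁ ∧ IsAlgebraic ℚ τ₂ ∧ 0 < R ∧ R ^ 2 = 1 + c₁ ^ 2 + c₂ ^ 2 ∧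
              τ₁ < τ₂ ∧
              (∀ p ∈ (fun z : Fin 2 → ℝ => ![z 1 * (c₁ + R * (1 - z 0 ^ 2) / (1 + z 0 ^ 2)), z 1 * (c₂ + 2 * R * z 0 / (1 + z 0 ^ 2))]) '' {z | τ₁ < z 0 ∧ z 0 < τ₂ ∧ 0 < z 1 ∧ z 1 < 1},
                -(starRingEnd ℂ b) * (((p 0 : ℝ) : ℂ) + ((p 1 : ℝ) : ℂ) * Complex.I) + starRingEnd ℂ a ≠ 0) ∧
              T'.domain = (fun p : Fin 2 → ℝ =>
            ![((a * (((p 0 : ℝ) : ℂ) + ((p 1 : ℝ) : ℂ) * Complex.I) + b) / (-(starRingEnd ℂ b) * (((p 0 : ℝ) : ℂ) + ((p 1 : ℝ) : ℂ) * Complex.I) +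
                starRingEnd ℂ a)).re,
              ((a * (((p 0 : ℝ) : ℂ) + ((p 1 : ℝ) : ℂ) * Complex.I) + b) / (-(starRingEnd ℂ b) * (((p 0 : ℝ) : ℂ) + ((p 1 : ℝ) : ℂ) * Complex.I) +
                starRingEnd ℂ a)).im]) ''
                ((fun z : Fin 2 → ℝ => ![z 1 * (c₁ + R * (1 - z 0 ^ 2) / (1 + z 0 ^ 2)), z 1 * (c₂ + 2 * R * z 0 / (1 + z 0 ^ 2))]) '' {z | τ₁ < z 0 ∧ z 0 < τ₂ ∧ 0 < z 1 ∧ z 1 < 1}) ∧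
              Set.EqOn T'.integrand (fun p => 4 / (1 + p 0 ^ 2 + p 1 ^ 2) ^ 2) T'.domain ∧ y = KZ.of T'}))))}
      add_mem' := by
        rintro x y ⟨N, hN, hx⟩ ⟨M, hM, hy⟩
        refine ⟨N * M, Nat.mul_ne_zero hN hM, ?_⟩
        rw [smul_add, mul_comm N M, mul_smul, mul_comm M N, mul_smul]
        exact add_mem (AddSubgroup.nsmul_mem _ hx M) (AddSubgroup.nsmul_mem _ hy N)
      zero_mem' := ⟨1, one_ne_zero, by rw [smul_zero]; exact zero_mem _⟩
      neg_mem' := by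
        rintro x ⟨N, hN, hx⟩
        exact ⟨N, hN, by rw [smul_neg]; exact neg_mem hx⟩ }
  have hWqS : KZ.relations ⊔ Wq ≤ KZ.relations ⊔ AddSubgroup.closure {d : KZ.FormalRep | ∃ ρ : ℂ → KZ.IntegralRep 3, (∀ z, IsAlgebraic ℚ z → 0 < z.im → (ρ z).domain = T z ∧ Set.EqOn (ρ z).integrand (fun p => 1 / p 2 ^ 3) (T z)) ∧ ∃ (k : ℕ) (z : Fin k → ℂ) (n : Fin k → ℤ), (∀ i, IsAlgebraic ℚ (z i)) ∧ (∀ i, 0 < (z i).im) ∧ ∑ i, (n i : ℝ) * (ρ (z i)).value = 0 ∧ d = ∑ i, n i • KZ.of (ρ (z i))} := by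
    refine sup_le le_sup_left fun x hx => ?_
    obtain ⟨N, hN, hNx⟩ := hx
    exact torsionFree_sup_closure_tetra T hT N hN x (hWS hNx)
  have hker := stub_kernelOfValueOne Wq (fun d G Q hQ hQ1 hGv =>
    stub_valueOneOfOrbit Wq d (fun K Q' hKc _ hK1 hQ' hQ'1 hKv =>
      stub_cubeDensityTransfer Wq d (fun G' Q'' hG' hG'0 hQ'' hQ''1 hG'v => by
        obtain ⟨N, hN, hmem⟩ := stub_rationalMoserModOracle T hT d G' Q'' hG' hG'0 hQ'' hQ''1 hG'v
        exact AddSubgroup.mem_sup_right ⟨N, hN, hmem⟩) K Q' hKc hK1 hQ' hQ'1 hKv)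
      G Q hQ hQ1 hGv) c hc
  exact hWqS hker

end Summit.KontsevichZagierPeriods.HyperbolicBloch.OffTetraSectorKernel

end
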